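import Summits.AtomisticToContinuum.HydrodynamicLimit.Theses.InformationPercolationEngine
import Summits.AtomisticToContinuum.HydrodynamicLimit.Theses.JParityClosure
import Literature.MathematicalPhysics.KineticTheory.HardSphereEulerProofs
import HarnessLib

/-!
# `InformationPercolationEngine.CollisionMomentBound` (stmt-AtomisticToContinuum-15144) implies
# `JParityClosure.CollisionTightness` (stmt-AtomisticToContinuum-13085): the bookkeeping bridge

Helper file (`--supports stmt-AtomisticToContinuum-15144`).  The support item `CollisionMomentBound` of
route `InformationPercolationEngine` (tightness under local Gibbs data of the velocity-weighted collision
functional `K_N[1 + ‖vᵢ‖² + ‖vⱼ‖²] = ε_N (N+1)⁻¹ Σ_{collision times s ≤ τ} Σ_{ordered contact pairs} (1 + ‖vᵢ(s)‖² + ‖vⱼ(s)‖²)`)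
is a STRENGTHENING of the support item `CollisionTightness` of route `JParityClosure` (tightness of the
normalised collision COUNT `ε_N (N+1)⁻¹ #{collision times in [0, τ]}`, stmt-AtomisticToContinuum-13085,
prover verdict `open-problem` 2026-08-16): on every good orbit each collision time carries at least one
ordered contact pair and the mark is `≥ 1`, so `ε_N (N+1)⁻¹ #collisions ≤ K_N[1 + ‖v‖² + ‖w‖²]`
pathwise, and the complement of the good set is null for every local Gibbs law.

* `numCollisions_le_collisionPairSum` — PATHWISE: on a hard-sphere trajectory,
  `#{collision times in [0, τ]} ≤ Σ_{collision times s ∈ [0,τ]} Σ_{ordered contact pairs (i,j)} F(s, i, j)`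
  for every mark `F ≥ 1`;
* `collisionTightness_of_collisionMomentBound` —
  `InformationPercolationEngine.CollisionMomentBound → JParityClosure.CollisionTightness`
  (same `σ₀`, `K = K_b`, `N₀`).

Consequence recorded on the item: `CollisionMomentBound` is at least as hard as the open item 13085
(speed-`N` large-deviation upper tails of the EQUILIBRIUM collision count are what both need beyond the
proved rung 0).
-/

noncomputable section

open MeasureTheory Set Filter Topology
open scoped ENNReal

namespace Summit.AtomisticToContinuum.HydrodynamicLimit.Theorems.CollisionMomentBound

open Literature.Analysis.FluidPDE Literature.MathematicalPhysics.KineticTheory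

/-- **Pathwise: the collision count is dominated by every ordered-pair collision sum with marks `≥ 1`.**
On a hard-sphere trajectory `γ` (locally finitely many collision times), for every horizon `τ` and every
mark `F(s, i, j) ≥ 1`,
`#{collision times in [0, τ]} ≤ Σ_{collision times s ∈ [0,τ]} Σ_{i ≠ j at contact at time s} F(s, i, j)`:
each collision time has at least one ordered pair at contact (definition of `collisionTimes`), whose
term is `≥ 1`, all other terms being `≥ 0`. [folklore] -/
theorem numCollisions_le_collisionPairSum {d X : Type*} [Fintype d] [TopologicalSpace X]
    {G : Geometry d X} {ε : ℝ} {n : ℕ} {γ : ℝ → Config n d X} (hγ : IsHardSphereTrajectory G ε n γ)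
    (τ : ℝ) {F : ℝ → Fin n → Fin n → ℝ} (hF : ∀ s i j, 1 ≤ F s i j) :
    (numCollisions G ε γ 0 τ : ℝ) ≤
      ∑ᶠ s ∈ collisionTimes G ε γ ∩ Icc 0 τ, ∑ i : Fin n, ∑ j : Fin n,
        (if i ≠ j ∧ ‖G.sepVec (γ s i).1 (γ s j).1‖ = ε then F s i j else 0) := by
  classical
  have hfin := hγ.locFinite 0 τ
  rw [hγ.numCollisions_eq, finsum_mem_eq_finite_toFinset_sum _ hfin]
  have hterm : ∀ (s : ℝ) (i j : Fin n),
      (0 : ℝ) ≤ (if i ≠ j ∧ ‖G.sepVec (γ s i).1 (γ s j).1‖ = ε then F s i j else 0) := by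
    intro s i j
    split_ifs
    · exact zero_le_one.trans (hF s i j)
    · exact le_rfl
  have h : ∀ s ∈ hfin.toFinset, (1 : ℝ) ≤ ∑ i : Fin n, ∑ j : Fin n,
      (if i ≠ j ∧ ‖G.sepVec (γ s i).1 (γ s j).1‖ = ε then F s i j else 0) := by
    intro s hs
    obtain ⟨⟨i, j, hij, hc⟩, -⟩ := hfin.mem_toFinset.1 hs
    have hcε : ‖G.sepVec (γ s i).1 (γ s j).1‖ = ε := hc.2
    calc (1 : ℝ) ≤ F s i j := hF s i j
      _ = (if i ≠ j ∧ ‖G.sepVec (γ s i).1 (γ s j).1‖ = ε then F s i j else 0) := by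
          rw [if_pos ⟨hij, hcε⟩]
      _ ≤ ∑ j' : Fin n, (if i ≠ j' ∧ ‖G.sepVec (γ s i).1 (γ s j').1‖ = ε then F s i j' else 0) :=
          Finset.single_le_sum (f := fun j' => (if i ≠ j' ∧ ‖G.sepVec (γ s i).1 (γ s j').1‖ = ε
            then F s i j' else 0)) (fun j' _ => hterm s i j') (Finset.mem_univ j)
      _ ≤ ∑ i' : Fin n, ∑ j' : Fin n,
            (if i' ≠ j' ∧ ‖G.sepVec (γ s i').1 (γ s j').1‖ = ε then F s i' j' else 0) :=
          Finset.single_le_sum (f := fun i' => ∑ j' : Fin n,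
            (if i' ≠ j' ∧ ‖G.sepVec (γ s i').1 (γ s j').1‖ = ε then F s i' j' else 0))
            (fun i' _ => Finset.sum_nonneg fun j' _ => hterm s i' j') (Finset.mem_univ i)
  calc ((hfin.toFinset.card : ℕ) : ℝ) = ∑ _s ∈ hfin.toFinset, (1 : ℝ) := by simp
    _ ≤ _ := Finset.sum_le_sum h

/-- **`CollisionMomentBound` implies `CollisionTightness`.** The velocity-weighted collision functional of
route `InformationPercolationEngine` dominates the normalised collision count of route `JParityClosure`
on the good set (`numCollisions_le_collisionPairSum` with the mark `1 + ‖vᵢ‖² + ‖vⱼ‖² ≥ 1`), and the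
complement of the good set is null for the local Gibbs law (`≪` Liouville); hence tightness of the
former gives tightness of the latter with the same `σ₀`, `K`, `N₀`. [folklore] -/
theorem collisionTightness_of_collisionMomentBound
    (h : _root_.Summit.AtomisticToContinuum.HydrodynamicLimit.Theses.InformationPercolationEngine.CollisionMomentBound) :
    _root_.Summit.AtomisticToContinuum.HydrodynamicLimit.Theses.JParityClosure.CollisionTightness := by
  intro a₀ θ₀ u₀ ha hθ hu ha0 hθ0
  obtain ⟨σ₀, hσ₀, H⟩ := h a₀ θ₀ u₀ ha hθ hu ha0 hθ0
  refine ⟨σ₀, hσ₀, fun σ hσ hσlt Φ τ hτ δ hδ => ?_⟩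
  obtain ⟨Kb, N₀, hK⟩ := H σ hσ hσlt Φ τ hτ δ hδ
  refine ⟨Kb, N₀, fun N hN => ?_⟩
  have hK' := hK N hN
  simp only [] at hK'
  have hgood0 : localGibbsLaw σ a₀ u₀ θ₀ N (Φ N) (Φ N).goodᶜ = 0 := by
    rw [localGibbsLaw_eq]
    exact localGibbsMeasure_absolutelyContinuous σ _ _ _ N (Φ N) (Φ N).measure_compl_good
  refine le_trans (measure_mono fun z hz => ?_)
    (((measure_union_le _ _).trans (add_le_add (le_of_eq hgood0) hK')).trans_eq (zero_add _))
  by_cases hgood : z ∈ (Φ N).good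
  · refine Or.inr ?_
    have hle := numCollisions_le_collisionPairSum ((Φ N).isTrajectory z hgood) τ
      (F := fun s i j => 1 + ‖((Φ N).flow s z i).2‖ ^ 2 + ‖((Φ N).flow s z j).2‖ ^ 2)
      (fun s i j => by nlinarith [sq_nonneg ‖((Φ N).flow s z i).2‖, sq_nonneg ‖((Φ N).flow s z j).2‖])
    exact lt_of_lt_of_le hz (mul_le_mul_of_nonneg_left hle
      (div_nonneg (hsDiameter_pos hσ N).le (by positivity)))
  · exact Or.inl hgood

end Summit.AtomisticToContinuum.HydrodynamicLimit.Theorems.CollisionMomentBound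

end
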